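import Literature.AlgebraicGeometry.HodgeTheory.WeilTypeIIGenericFibreEndomorphismAlgebra
import Literature.AlgebraicGeometry.Motives.AbelianVarietySimpleOfEndAlgebraDomain
import Literature.Geometry.Kaehler.ComplexTorusQuaternionFamilyNegOnePrime
import HarnessLib

/-!
# The generic type-II fibre of the FIRST non-split sixfold cell `(ℚ(√-3), 6, [-2])` is SIMPLE: `(-3, 2)_ℚ` is a skew field

Family `hodge`, layer `Literature/AlgebraicGeometry/HodgeTheory`; THEOREMS ONLY (no definition, no named fact, no
`sorry`; D-0026). Sequel to `HodgeTheory/WeilTypeIIGenericFibreEndomorphismAlgebra` (modulo [U] / J1, the generic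
type-II fibre `Y_s` of the cell of class `[u]` over `ℚ(√-d)` has `End⁰(Y_s) ≃ₐ ℍ[ℚ, -d, -u] = D_δ`). By Mumford §19
Cor. 2 (tree: `AbelianVariety.isSimple_of_forall_exists_mul_eq_one`, Poincaré's complete reducibility) such a fibre
is SIMPLE as soon as `D_δ` is a skew field; and for the FIRST CELL of the vhodge route
(`n = 3`, `d = 3`, `δ = [-2]`: `Cruxes/NonsplitSixfoldCells/Lines/birth.lean`) the algebra `D₆ = (-3, 2)_ℚ` IS a skew
field — its norm form `x₀² + 3x₁² - 2x₂² - 6x₃²` is anisotropic over `ℚ` by descent at `3` (`-1` is not a square mod `3`;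
equivalently `(-3, 2)_3 = (2/3) = -1`, `D₆` is ramified at `3`), checked through Bergeron's criterion
(tree: `ComplexTorus.QuaternionType.forall_isUnit_iff_forall_norm_ne_zero`).

* `norm_ne_zero_neg_three_two`, `forall_isUnit_quaternionAlgebra_neg_three_two` — `(-3, 2)_ℚ` is a skew field;
* `AbelianVariety.isSimple_of_algEquiv_of_forall_isUnit` — `End⁰(A) ≃ₐ Q`, `Q` a skew field ⟹ `A` simple;
* `exists_simple_typeII_generic_fibre_of_periodSurjective` — [U]-version: if `(-d, -u)_ℚ` is a skew field, the generic
  type-II fibre is SIMPLE with `End⁰ ≃ₐ (-d, -u)_ℚ`;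
* `exists_simple_typeII_generic_fibre_of_periodConstructionAtWeilType` — the same in Deligne's family, modulo J1;
* `exists_simple_generic_fibre_firstSixfoldCell_of_periodConstructionAtWeilType` — **modulo J1 alone, Deligne's family
  through every member `(P, ψ₀, h_K)` of Weil type `(3, 3)` over `ℚ(√-3)` of discriminant class `[-2]` has a SIMPLE
  fibre, an abelian sixfold `Y_s` with `End⁰(Y_s) ≃ₐ[ℚ] (-3, 2)_ℚ`, carrying `ψ` with `Ψ_s ψ = -ψ Ψ_s`, `ψ² = 2r²·𝟙`** —
  the director's «GENERIC SIMPLE type-II member» of the first cell, as a fibre (vhodge ROUTE-P3-g17 §3 (b)(c)).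

HONEST REMARKS. J1 / [U] is a HYPOTHESIS; nothing here proves a case of the Hodge conjecture; for a general cell the
skew-field property of `D_δ` is an explicit hypothesis `hQ` (it fails exactly when `D_δ ≅ M₂(ℚ)`, which for `δ` non-split
does not happen — `D_δ` split ⟺ `-δ₀ ∈ Nm(K^*)` — but that equivalence is not formalised here); the Mumford–Tate group,
Néron–Severi rank and Weil/Hodge classes of `Y_s` are not addressed.

## References

* [MumfordAV1970] D. Mumford, *Abelian Varieties* (1970), §19 Cor. 2 of Thm. 1 (p. 174).
* [Bergeron2016] N. Bergeron, *The Spectrum of Hyperbolic Surfaces* (2016), §2.2 pp. 36–37 (descent), §2.2.3 p. 40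
  (division criterion).
* [VignerasLNM800] M.-F. Vignéras, LNM 800 (1980), Ch. I §2 Cor. 2.4, Ch. III §3 (ramification and Hilbert symbols).
* [Shimura1963AnalyticFamilies] G. Shimura, Ann. of Math. 78 (1963), §4 (Type II).
* [vanGeemenVerra2003QuaternionicPryms] B. van Geemen, A. Verra, Topology 42 (2003), §4 (the sixfolds with `D₆`).
* [Deligne1982HodgeCycles] P. Deligne, LNM 900 (1982), §4, proof of Thm. 4.8.
-/

noncomputable section

open CategoryTheory AlgebraicGeometry Module
open scoped TensorProduct Quaternion
open Literature.AlgebraicTopology.SingularHomology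
open Literature.AlgebraicGeometry Literature.AlgebraicGeometry.Motives
open Literature.AlgebraicGeometry.VanGeemen1994
open Literature.Geometry.Kaehler.ComplexTorus.QuaternionType

namespace Literature.AlgebraicGeometry.HodgeTheory

/-! ## §1 `(-3, 2)_ℚ` is a skew field (descent at `3`) -/

/-- **Descent at `3`**: the norm form `x₀² + 3x₁² - 2x₂² - 6x₃²` of `(-3, 2)_ℚ` has no integral zero `≠ 0` —
`3 ∣ x₀² - 2x₂² ≡ x₀² + x₂²` forces `3 ∣ x₀, x₂` (`-1` is not a square mod `3`), then `3 ∣ x₁² - 2x₃²` forces `3 ∣ x₁, x₃`,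
and `x/3` is a smaller zero (Bergeron's descent for `Γ_{p,p}`, here at the prime `3 ≡ 3 (mod 4)`).
[cite: Bergeron2016, §2.2 pp. 36–37] -/
theorem norm_ne_zero_neg_three_two (m : Fin 4 → ℤ) (hm : m ≠ 0) :
    m 0 ^ 2 - (-3) * m 1 ^ 2 - 2 * m 2 ^ 2 + (-3) * 2 * m 3 ^ 2 ≠ 0 := by
  haveI : Fact (Nat.Prime 3) := ⟨Nat.prime_three⟩
  -- infinite descent on `|m₀| + |m₁| + |m₂| + |m₃|`
  suffices h : ∀ n : ℕ, ∀ m : Fin 4 → ℤ, (m 0).natAbs + (m 1).natAbs + (m 2).natAbs + (m 3).natAbs = n →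
      m ≠ 0 → m 0 ^ 2 - (-3) * m 1 ^ 2 - 2 * m 2 ^ 2 + (-3) * 2 * m 3 ^ 2 ≠ 0 from h _ m rfl hm
  intro n
  induction n using Nat.strong_induction_on with
  | _ n ih =>
    intro m hn hm hN
    -- `3 ∣ m₀² + m₂²`
    have h02 : ((3 : ℕ) : ℤ) ∣ m 0 ^ 2 + m 2 ^ 2 := ⟨m 2 ^ 2 - m 1 ^ 2 + 2 * m 3 ^ 2, by linear_combination hN⟩
    obtain ⟨⟨y0, hy0⟩, ⟨y2, hy2⟩⟩ := dvd_of_dvd_sq_add_sq (p := 3) rfl h02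
    -- then `3 ∣ m₁² + m₃²`
    have h13 : ((3 : ℕ) : ℤ) ∣ m 1 ^ 2 + m 3 ^ 2 := ⟨m 3 ^ 2 + 2 * y2 ^ 2 - y0 ^ 2, by
      have : (3 : ℤ) * (m 1 ^ 2 + m 3 ^ 2) = 3 * (3 * (m 3 ^ 2 + 2 * y2 ^ 2 - y0 ^ 2)) := by
        rw [hy0, hy2] at hN
        push_cast at hN
        linear_combination hN
      push_cast
      exact mul_left_cancel₀ (by norm_num : (3 : ℤ) ≠ 0) this⟩
    obtain ⟨⟨y1, hy1⟩, ⟨y3, hy3⟩⟩ := dvd_of_dvd_sq_add_sq (p := 3) rfl h13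
    -- the smaller zero `y = m / 3`
    set y : Fin 4 → ℤ := ![y0, y1, y2, y3] with hy
    have hmy : ∀ k, m k = 3 * y k := by
      intro k
      fin_cases k <;> simp [hy, hy0, hy1, hy2, hy3]
    have hy_ne : y ≠ 0 := by
      intro h0
      apply hm
      funext k
      rw [hmy k, h0, Pi.zero_apply, mul_zero]
    have hNy : y 0 ^ 2 - (-3) * y 1 ^ 2 - 2 * y 2 ^ 2 + (-3) * 2 * y 3 ^ 2 = 0 := by
      have : (3 : ℤ) ^ 2 * (y 0 ^ 2 - (-3) * y 1 ^ 2 - 2 * y 2 ^ 2 + (-3) * 2 * y 3 ^ 2) = 0 := by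
        rw [hmy 0, hmy 1, hmy 2, hmy 3] at hN
        linear_combination hN
      exact (mul_eq_zero.mp this).resolve_left (by norm_num)
    have habs : ∀ k, (m k).natAbs = 3 * (y k).natAbs := fun k ↦ by
      rw [hmy k, Int.natAbs_mul]
      rfl
    have hpos : 0 < (y 0).natAbs + (y 1).natAbs + (y 2).natAbs + (y 3).natAbs := by
      by_contra h0
      apply hy_ne
      funext k
      have hk : (y k).natAbs = 0 := by fin_cases k <;> simp <;> omega
      rw [Pi.zero_apply]
      exact Int.natAbs_eq_zero.mp hk
    have hlt : (y 0).natAbs + (y 1).natAbs + (y 2).natAbs + (y 3).natAbs < n := by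
      rw [← hn, habs 0, habs 1, habs 2, habs 3]
      omega
    exact ih _ hlt y rfl hy_ne hNy

/-- **`D₆ = (-3, 2)_ℚ` is a skew field**: every non-zero element of `ℍ[ℚ,-3,2]` is a unit (Bergeron's division
criterion `forall_isUnit_iff_forall_norm_ne_zero` + the descent `norm_ne_zero_neg_three_two`; equivalently `D₆` is
ramified at `3`). This is the quaternion algebra `D_δ = (-d, -δ₀)_ℚ` of the first non-split sixfold cell
`(ℚ(√-3), 6, δ = [-2])` of the vhodge route. [cite: Bergeron2016, §2.2.3 p. 40] [cite: VignerasLNM800, Ch. I §2 Cor. 2.4] -/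
theorem forall_isUnit_quaternionAlgebra_neg_three_two : ∀ x : ℍ[ℚ,-3,2], x ≠ 0 → IsUnit x := by
  have h := (forall_isUnit_iff_forall_norm_ne_zero (-3) 2).mpr fun m hm ↦ norm_ne_zero_neg_three_two m hm
  have e1 : ((-3 : ℤ) : ℚ) = -3 := by norm_num
  have e2 : ((2 : ℤ) : ℚ) = 2 := by norm_num
  rw [e1, e2] at h
  exact h

/-! ## §2 `End⁰(A)` a skew field ⟹ `A` simple -/

/-- **`End⁰(A) ≅ Q` with `Q` a skew field ⟹ `A` is simple** (Mumford §19 Cor. 2; the tree's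
`AbelianVariety.isSimple_of_forall_exists_mul_eq_one`, Poincaré's complete reducibility, transported along an algebra
isomorphism). [cite: MumfordAV1970, §19 Cor. 2 of Thm. 1 (p. 174)] -/
theorem AbelianVariety.isSimple_of_algEquiv_of_forall_isUnit {A : AbelianVariety ℂ} {Q : Type*} [Ring Q]
    [Algebra ℚ Q] (e : A.endAlgebra ≃ₐ[ℚ] Q) (hQ : ∀ x : Q, x ≠ 0 → IsUnit x) : AbelianVariety.IsSimple A := by
  refine AbelianVariety.isSimple_of_forall_exists_mul_eq_one fun x hx => ?_
  obtain ⟨u, hu⟩ := hQ (e x) ((map_ne_zero_iff e e.injective).2 hx)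
  refine ⟨e.symm (↑u⁻¹ : Q), e.injective ?_⟩
  rw [map_mul, e.apply_symm_apply, ← hu, Units.mul_inv, map_one]

/-! ## §3 A SIMPLE generic type-II fibre -/

section TypeII

variable {n d : ℕ}

/-- **A SIMPLE GENERIC TYPE-II FIBRE, [U]-version.** In the setting of
`exists_typeII_generic_endomorphismAlgebra_of_periodSurjective` (odd `n`, Weil-type `(P, ψ₀, h_K)` of class `[u]`,
`u < 0`, any [U]-period-surjective family with `Ψ_s² = -d`), IF the quaternion algebra `(-d, -u)_ℚ` is a skew field,
then some fibre `Y_s` is a SIMPLE abelian variety with `End⁰(Y_s) ≃ₐ[ℚ] (-d, -u)_ℚ`, carrying `ψ` with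
`Ψ_s ψ = -ψ Ψ_s`, `ψ² = r²(-u)·𝟙`. [cite: Shimura1963AnalyticFamilies, §4 (Type II)] [cite: MumfordAV1970, §19 Cor. 2]
[cite: vanGeemen1994HodgeAV, proof of Thm. 6.11] [cite: Deligne1982HodgeCycles, proof of Thm. 4.8] -/
theorem exists_simple_typeII_generic_fibre_of_periodSurjective (hodd : Odd n)
    {P : AbelianVariety ℂ} (hP : P.dim = 2 * n) {ψ₀ : P ⟶ P}
    (e : ProjectiveEmbedding P.X) {a : complexBetti (projectiveSpace e.n ℂ) 2}
    (ha : IsRationalClass a) (ha0 : a ≠ 0)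
    (hweilP : ∃ c ∈ weilClassesOf P ψ₀ n d, c ≠ 0 ∧ IsOfHodgeType (2 * n) P.X (2 * n) n n c)
    (u : ℚˣ) (hu : (u : ℚ) < 0) (hQ : ∀ x : ℍ[ℚ,-(d : ℚ),-(u : ℚ)], x ≠ 0 → IsUnit x)
    (hδP : HasWeilDiscriminantNondeg P ψ₀ n d
      ((d : ℂ) • complexBetti.map e.ι 2 a + complexBetti.map ψ₀.hom.hom.hom 2 (complexBetti.map e.ι 2 a))
      (QuotientGroup.mk u))
    {S : Type*} (Y : S → AbelianVariety ℂ) (Ψ : ∀ s, Y s ⟶ Y s) (hY : ∀ s, (Y s).dim = 2 * n)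
    (hΨ : ∀ s, Ψ s ≫ Ψ s = -(d • 𝟙 (Y s)))
    (hU : ∃ (m : ℕ) (hm : 1 ≤ m) (hPm : P.dim = m + 1) (hd : 0 < d) (hψ : ψ₀ ≫ ψ₀ = -(d • 𝟙 P))
        (ω : complexBetti P.X (2 + 2 * m)) (hω : IsRationalClass ω) (hω0 : ω ≠ 0),
        ∀ (J : (weilDatumOfKsymm hm hPm hd hψ e ha ha0 hω hω0).Cx →ₗ[ℂ]
            (weilDatumOfKsymm hm hPm hd hψ e ha ha0 hω hω0).Cx)
          (hW : IsWeilComplexStructure (weilDatumOfKsymm hm hPm hd hψ e ha ha0 hω hω0).hForm J),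
          ∃ (s : S) (β : bettiCohomology P.X 1 ≃ₗ[ℚ] bettiCohomology (Y s).X 1),
            (∀ x, β (bettiCohomology.map ψ₀.hom.hom.hom 1 x) = bettiCohomology.map (Ψ s).hom.hom.hom 1 (β x)) ∧
            ∀ x ∈ ((weilDatumOfKsymm hm hPm hd hψ e ha ha0 hω hω0).hodgeStructure J hW.sq).piece 1 0,
              IsOfHodgeType (2 * n) (Y s).X 1 1 0
                (Motives.ofRatClassBaseChange (ComplexPoints (Y s).X) 1 (β.toLinearMap.baseChange ℂ x))) :
    ∃ (s : S) (ψ : Y s ⟶ Y s) (c : ℕ), 0 < c ∧ Ψ s ≫ ψ = -(ψ ≫ Ψ s) ∧ ψ ≫ ψ = c • 𝟙 (Y s) ∧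
      (∃ r : ℚ, r ≠ 0 ∧ (c : ℚ) = r ^ 2 * (-(u : ℚ))) ∧
      Nonempty ((Y s).endAlgebra ≃ₐ[ℚ] ℍ[ℚ,-(d : ℚ),-(u : ℚ)]) ∧ AbelianVariety.IsSimple (Y s) := by
  obtain ⟨s, ψ, c, hc, hanti, hsq, hr, ⟨e₁⟩⟩ :=
    exists_typeII_generic_endomorphismAlgebra_of_periodSurjective hodd hP e ha ha0 hweilP u hu hδP Y Ψ hY hΨ hU
  exact ⟨s, ψ, c, hc, hanti, hsq, hr, ⟨e₁⟩, AbelianVariety.isSimple_of_algEquiv_of_forall_isUnit e₁ hQ⟩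

/-- **A SIMPLE GENERIC TYPE-II FIBRE IN DELIGNE'S FAMILY, MODULO J1.** Granted Deligne's period construction
(`deligne1982_weilFamily_periodConstructionAtWeilType`, the NAMED FACT «J1», a HYPOTHESIS here): for every abelian
`2n`-fold `(P, ψ₀, h_K)` of Weil type `(n, n)`, `n` odd, `d ≥ 1`, of non-degenerate discriminant class `[u]`, `u < 0`,
such that `(-d, -u)_ℚ` is a skew field, Deligne's family through `P` (clauses (1), (2), (6) re-exported) has a SIMPLE
fibre `Y_s` with `End⁰(Y_s) ≃ₐ[ℚ] (-d, -u)_ℚ` carrying `ψ` (`Ψ_s ψ = -ψ Ψ_s`, `ψ² = r²(-u)·𝟙`).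
[cite: Deligne1982HodgeCycles, §4 Prop. 4.4 and proof of Thm. 4.8] [cite: Shimura1963AnalyticFamilies, §4 (Type II)]
[cite: MumfordAV1970, §19 Cor. 2 of Thm. 1] [cite: vanGeemen1994HodgeAV, 5.3–5.8 and proof of Thm. 6.11] -/
theorem exists_simple_typeII_generic_fibre_of_periodConstructionAtWeilType
    (hJ : deligne1982_weilFamily_periodConstructionAtWeilType) (hodd : Odd n) (hd : 1 ≤ d)
    {P : AbelianVariety ℂ} {ψ₀ : P ⟶ P} (hWT : IsWeilType P ψ₀ n d)
    (e : ProjectiveEmbedding P.X) {a : complexBetti (projectiveSpace e.n ℂ) 2}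
    (ha : IsRationalClass a) (ha0 : a ≠ 0) (u : ℚˣ) (hu : (u : ℚ) < 0)
    (hQ : ∀ x : ℍ[ℚ,-(d : ℚ),-(u : ℚ)], x ≠ 0 → IsUnit x)
    (hδP : HasWeilDiscriminantNondeg P ψ₀ n d
      ((d : ℂ) • complexBetti.map e.ι 2 a + complexBetti.map ψ₀.hom.hom.hom 2 (complexBetti.map e.ι 2 a))
      (QuotientGroup.mk u)) :
    ∃ (𝒳 S : SchemeOver ℂ) (f : 𝒳 ⟶ S) (g : 𝒳 ⟶ 𝒳) (s₀ : ComplexPoints S)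
      (e' : P.X ≅ fiberOver f s₀)
      (Y : ComplexPoints S → AbelianVariety ℂ) (Ψ : ∀ s, Y s ⟶ Y s)
      (ε : ∀ s, (Y s).X ≅ fiberOver f s) (N : ℕ)
      (ι : 𝒳 ⟶ CategoryTheory.MonoidalCategoryStruct.tensorObj (projectiveSpace N ℂ) S)
      (a' : complexBetti (projectiveSpace N ℂ) 2),
      IsSmoothProjectiveFamily f (2 * n) ∧
      AlgebraicGeometry.IsClosedImmersion ι.left ∧
      ι ≫ CategoryTheory.CartesianMonoidalCategory.snd (projectiveSpace N ℂ) S = f ∧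
      IrreducibleSpace S.left ∧ AlgebraicGeometry.Smooth S.hom ∧ IsQuasiProjectiveOver S ∧
      g ≫ f = f ∧
      (e'.hom ≫ fiberι f s₀) ≫ g = ψ₀.hom.hom.hom ≫ (e'.hom ≫ fiberι f s₀) ∧
      (∀ s, (Y s).dim = 2 * n ∧ Ψ s ≫ Ψ s = -((d : ℤ) • 𝟙 (Y s)) ∧
        ((ε s).hom ≫ fiberι f s) ≫ g = (Ψ s).hom.hom.hom ≫ ((ε s).hom ≫ fiberι f s)) ∧
      IsRationalClass a' ∧
      complexBetti.map e'.hom 2 (complexBetti.map (fiberι f s₀) 2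
        (complexBetti.map
          (ι ≫ CategoryTheory.CartesianMonoidalCategory.fst (projectiveSpace N ℂ) S) 2 a')) =
        (d : ℂ) • complexBetti.map e.ι 2 a +
          complexBetti.map ψ₀.hom.hom.hom 2 (complexBetti.map e.ι 2 a) ∧
      ∃ (s : ComplexPoints S) (ψ : Y s ⟶ Y s) (c : ℕ), 0 < c ∧ Ψ s ≫ ψ = -(ψ ≫ Ψ s) ∧
        ψ ≫ ψ = c • 𝟙 (Y s) ∧ (∃ r : ℚ, r ≠ 0 ∧ (c : ℚ) = r ^ 2 * (-(u : ℚ))) ∧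
        Nonempty ((Y s).endAlgebra ≃ₐ[ℚ] ℍ[ℚ,-(d : ℚ),-(u : ℚ)]) ∧ AbelianVariety.IsSimple (Y s) := by
  have hn : 1 ≤ n := hodd.pos
  have hP : P.dim = 2 * n := hWT.dim_eq
  have hψZ : ψ₀ ≫ ψ₀ = -((d : ℤ) • 𝟙 P) := by rw [natCast_zsmul]; exact hWT.sq_eq
  -- a non-zero Weil class of type `(n, n)` (the Weil plane is a plane; van Geemen 4.10 / 5.2 (5)–(6))
  have hweilP : ∃ c ∈ weilClassesOf P ψ₀ n d, c ≠ 0 ∧ IsOfHodgeType (2 * n) P.X (2 * n) n n c := by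
    have h2 := hWT.finrank_weilClassesOf
    have hne : weilClassesOf P ψ₀ n d ≠ ⊥ := by
      intro h
      rw [h, finrank_bot] at h2
      exact two_ne_zero h2.symm
    obtain ⟨c, hc, hc0⟩ := (Submodule.ne_bot_iff _).1 hne
    exact ⟨c, hc, hc0, hWT.isOfHodgeType_of_mem_weilClassesOf hc⟩
  obtain ⟨𝒳, S, f, g, s₀, e', Y, Ψ, ε, N, ι, a', hfam, hιcl, hιf, hirr, hsm, hqp, hgf, hge', hY, -, hU, ha'r,
    ha'pol⟩ := hJ n d hn hd P ψ₀ e a hP hψZ ha ha0 hWT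
  obtain ⟨s, ψ, c, hc, hanti, hsq, hr, hEnd, hsimple⟩ := exists_simple_typeII_generic_fibre_of_periodSurjective hodd
    hP e ha ha0 hweilP u hu hQ hδP Y Ψ (fun s => (hY s).1) (fun s => by rw [(hY s).2.1, natCast_zsmul]) hU
  exact ⟨𝒳, S, f, g, s₀, e', Y, Ψ, ε, N, ι, a', hfam, hιcl, hιf, hirr, hsm, hqp, hgf, hge', hY, ha'r, ha'pol,
    s, ψ, c, hc, hanti, hsq, hr, hEnd, hsimple⟩

/-- **THE FIRST NON-SPLIT SIXFOLD CELL HAS A SIMPLE GENERIC FIBRE, MODULO J1.** For the first cell of the vhodge route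
(`K = ℚ(√-3)`, dimension `6`, discriminant class `δ = [-2]`; `D₆ = (-3, 2)_ℚ`): granted J1, Deligne's family through
every member `(P, ψ₀, h_K)` of Weil type `(3, 3)` over `ℚ(√-3)` whose `K`-symmetrised hyperplane class has a
non-degenerate discriminant witness of class `[-2]` has a fibre `Y_s` which is a SIMPLE abelian sixfold with
`End⁰(Y_s) ≃ₐ[ℚ] (-3, 2)_ℚ`, carrying `ψ` with `Ψ_s ψ = -ψ Ψ_s`, `ψ² = c·𝟙`, `c = 2r²` — the GENERIC SIMPLE type-II
member of the cell realised as a fibre (`(-3, 2)_ℚ` is a skew field: `forall_isUnit_quaternionAlgebra_neg_three_two`).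
[cite: Deligne1982HodgeCycles, §4 Prop. 4.4 and proof of Thm. 4.8] [cite: Shimura1963AnalyticFamilies, §4 (Type II)]
[cite: vanGeemenVerra2003QuaternionicPryms, §4 (abelian sixfolds with D₆)] [cite: MumfordAV1970, §19 Cor. 2 of Thm. 1] -/
theorem exists_simple_generic_fibre_firstSixfoldCell_of_periodConstructionAtWeilType
    (hJ : deligne1982_weilFamily_periodConstructionAtWeilType)
    {P : AbelianVariety ℂ} {ψ₀ : P ⟶ P} (hWT : IsWeilType P ψ₀ 3 3)
    (e : ProjectiveEmbedding P.X) {a : complexBetti (projectiveSpace e.n ℂ) 2}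
    (ha : IsRationalClass a) (ha0 : a ≠ 0) (u : ℚˣ) (hu2 : (u : ℚ) = -2)
    (hδP : HasWeilDiscriminantNondeg P ψ₀ 3 3
      (((3 : ℕ) : ℂ) • complexBetti.map e.ι 2 a + complexBetti.map ψ₀.hom.hom.hom 2 (complexBetti.map e.ι 2 a))
      (QuotientGroup.mk u)) :
    ∃ (𝒳 S : SchemeOver ℂ) (f : 𝒳 ⟶ S) (g : 𝒳 ⟶ 𝒳) (s₀ : ComplexPoints S)
      (e' : P.X ≅ fiberOver f s₀)
      (Y : ComplexPoints S → AbelianVariety ℂ) (Ψ : ∀ s, Y s ⟶ Y s)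
      (ε : ∀ s, (Y s).X ≅ fiberOver f s) (N : ℕ)
      (ι : 𝒳 ⟶ CategoryTheory.MonoidalCategoryStruct.tensorObj (projectiveSpace N ℂ) S)
      (a' : complexBetti (projectiveSpace N ℂ) 2),
      IsSmoothProjectiveFamily f (2 * 3) ∧
      AlgebraicGeometry.IsClosedImmersion ι.left ∧
      ι ≫ CategoryTheory.CartesianMonoidalCategory.snd (projectiveSpace N ℂ) S = f ∧
      IrreducibleSpace S.left ∧ AlgebraicGeometry.Smooth S.hom ∧ IsQuasiProjectiveOver S ∧
      g ≫ f = f ∧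
      (e'.hom ≫ fiberι f s₀) ≫ g = ψ₀.hom.hom.hom ≫ (e'.hom ≫ fiberι f s₀) ∧
      (∀ s, (Y s).dim = 2 * 3 ∧ Ψ s ≫ Ψ s = -(((3 : ℕ) : ℤ) • 𝟙 (Y s)) ∧
        ((ε s).hom ≫ fiberι f s) ≫ g = (Ψ s).hom.hom.hom ≫ ((ε s).hom ≫ fiberι f s)) ∧
      IsRationalClass a' ∧
      complexBetti.map e'.hom 2 (complexBetti.map (fiberι f s₀) 2
        (complexBetti.map
          (ι ≫ CategoryTheory.CartesianMonoidalCategory.fst (projectiveSpace N ℂ) S) 2 a')) =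
        ((3 : ℕ) : ℂ) • complexBetti.map e.ι 2 a +
          complexBetti.map ψ₀.hom.hom.hom 2 (complexBetti.map e.ι 2 a) ∧
      ∃ (s : ComplexPoints S) (ψ : Y s ⟶ Y s) (c : ℕ), 0 < c ∧ Ψ s ≫ ψ = -(ψ ≫ Ψ s) ∧
        ψ ≫ ψ = c • 𝟙 (Y s) ∧ (∃ r : ℚ, r ≠ 0 ∧ (c : ℚ) = r ^ 2 * 2) ∧
        Nonempty ((Y s).endAlgebra ≃ₐ[ℚ] ℍ[ℚ,-3,2]) ∧ AbelianVariety.IsSimple (Y s) := by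
  have hu : (u : ℚ) < 0 := by rw [hu2]; norm_num
  have e1 : (-((3 : ℕ) : ℚ)) = -3 := by norm_num
  have e2 : (-(u : ℚ)) = 2 := by rw [hu2]; norm_num
  have hQ : ∀ x : ℍ[ℚ,-((3 : ℕ) : ℚ),-(u : ℚ)], x ≠ 0 → IsUnit x := by
    rw [e1, e2]
    exact forall_isUnit_quaternionAlgebra_neg_three_two
  obtain ⟨𝒳, S, f, g, s₀, e', Y, Ψ, ε, N, ι, a', hfam, hιcl, hιf, hirr, hsm, hqp, hgf, hge', hY, ha'r, ha'pol,
    s, ψ, c, hc, hanti, hsq, ⟨r, hr, hcr⟩, hEnd, hsimple⟩ :=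
    exists_simple_typeII_generic_fibre_of_periodConstructionAtWeilType hJ (n := 3) (d := 3) ⟨1, rfl⟩ (by norm_num)
      hWT e ha ha0 u hu hQ hδP
  refine ⟨𝒳, S, f, g, s₀, e', Y, Ψ, ε, N, ι, a', hfam, hιcl, hιf, hirr, hsm, hqp, hgf, hge', hY, ha'r, ha'pol,
    s, ψ, c, hc, hanti, hsq, ⟨r, hr, by rw [hcr, hu2]; norm_num⟩, ?_, hsimple⟩
  rw [e1, e2] at hEnd
  exact hEnd

end TypeII

end Literature.AlgebraicGeometry.HodgeTheory

end
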